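import Summits.BirchSwinnertonDyer.BirchSwinnertonDyer.Theorems.ByReductionTypeAtTwoAdditivePotGoodPrintKrizLi
import Summits.BirchSwinnertonDyer.BirchSwinnertonDyer.Theorems.ByReductionTypeAtTwoAdditivePotGoodPrintKrizLi44a1Base
import Literature.NumberTheory.EllipticCurves.KrizLi2019.Table2RankZeroRows
import Mathlib.Tactic.NormNum.LegendreSymbol
import HarnessLib

/-!
# K4 crux `AdditiveRankZeroAtTwo` (19098), children C3″ (22617) / C1″ (22615): THE KRIZ–LI ROAD AT THE BASE `44a1` OVER `K = ℚ(√−7)` —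
# `BSD(·, 2)` (both K4 halves) on `{44a1^{(d)}}` and the rank-one companions `{44a1^{(−7d)}}`, `d ∈ 𝒩(44a1, K)`, `χ_d(−44) = 1`,
# from the PRINTED Table-2 row `44a1 | −7 | 3 | ✓` (`KrizLi2019.table2_row44a1`) BY NAME

Cell `bsd-2adic`, seat `bsd-2adic-k4-w2` GEN 7 (prover, explicit unit, no kit); `--supports stmt-BirchSwinnertonDyer-22617 --as helper`.
HONEST FRAMING (D-0036/D-0054): the generic road (`…PrintKrizLi.lean`) instantiated at `V = 44a1 = [0,1,0,3,−1]` — ADDITIVE (`IV*`) and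
POTENTIALLY GOOD at `2` (`ord₂ j = 13`), non-CM, `E[2]` irreducible, `N = 44` (kernel, `…PrintKrizLi44a1Base.lean` + GEN 6's base section) —
and `K` ANY imaginary quadratic field with `d_K = −7` (e.g. the tree's `sqrtField (−7)`). KERNEL here: the Heegner hypothesis for `(44, −7)`
(`2` and `11` split), `E(ℚ)[2] = 0` in Kriz–Li's shape, Kriz–Li's local hypotheses at `2` (`c₂ = 3` odd from the Tate certificate; the odd
Manin constant of the OPTIMAL datum by print, Agashe–Ribet–Stein Thm. 2.6 at level `44 ≤ 130000`). PRINT BY NAME: Kriz–Li Thm 5.1 (2) / Thm 4.3,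
Creutz–Miller (`BSD(44a1, 2)`, `BSD(44a1^{(−7)}, 2)`: conductors `44`, `2156`), ARS Thm. 2.6, GZK (halves bookkeeping), and the Table-2 row
(optimal datum + Heegner point with (★)). DISPLAYED: only `r_an(44a1) = 0` (Cremona's Table 1 `r = 0`; Kriz–Li's caption «rank zero curves»)
in the K4-keyed sorting — `BSD(·, 2)` on the whole family needs NO displayed input. `d ∈ 𝒩` and `χ_d(−44) = 1` are Kriz–Li's conditions on the
member (witness `d = −23` in `…PrintKrizLi44a1Witness.lean`). Closes nothing at the `∀`-level (C3″/C1″ research-open); nothing booked; BSD is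
not proved by any of this.

References: [KrizLi2019] Thm 5.1 (2), Thm 4.3, Def 4.1, §6 Ex. 6.4–6.5, Table 2 (row 44a1); [CreutzMiller2012] Thm 1.1; [AgasheRibetStein2006]
Thm 2.6; [Miller2011LMS] Def 1.1; [CremonaAlgorithms1997] Table 1 (44A1); [Marcus1977] Ch. 3 Thm. 25.
-/

set_option autoImplicit false
-- the Theorems namespace of this sub repeats the summit name by design (D-0017 nested layout)
set_option linter.dupNamespace false

noncomputable section

open scoped Classical

open WeierstrassCurve NumberField Literature.NumberTheory.EllipticCurves
  Literature.NumberTheory.EllipticCurves.ModularForms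
  Literature.NumberTheory.EllipticCurves.Rank1Residual
  Literature.NumberTheory.EllipticCurves.Rank1Residual.Typed
  Literature.NumberTheory.EllipticCurves.AgasheRibetStein2006
  Summit.BirchSwinnertonDyer.Rank1Residual
  Summit.BirchSwinnertonDyer.Rank1Residual.P2

namespace Summit.BirchSwinnertonDyer.BirchSwinnertonDyer.Theorems.AddPotGoodPrint

/-! ## §1 The Heegner field `K`, `d_K = −7`: `2` and `11` split; Kriz–Li's standing hypotheses at `44a1` -/
section Base44A1Field

/-- **The Heegner hypothesis for `(44a1, K)`, `d_K = −7`**: every prime of `N = 44` splits in `K` (`−7 ≡ 1 (mod 8)`; `(−7/11) = (4/11) = 1`).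
[cite: KrizLi2019, Thm. 5.1 hypothesis "K satisfies the Heegner hypothesis for N"] [cite: Marcus1977, Ch. 3 Thm. 25] -/
theorem satisfiesHeegnerHypothesis_44A1 {K : Type} [Field K] [NumberField K] (h2 : Module.finrank ℚ K = 2)
    (hdK : NumberField.discr K = -7) :
    haveI := isElliptic_44A1
    SatisfiesHeegnerHypothesis ((⟨0, 1, 0, 3, -1⟩ : WeierstrassCurve ℚ).conductorNorm ℤ) K := by
  rw [conductorNorm_44A1, satisfiesHeegnerHypothesis_iff_kronecker _ K h2, hdK]
  intro q hq hqN
  have hq' : q ∣ 2 ^ 2 * 11 := by simpa using hqN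
  rcases (Nat.Prime.dvd_mul hq).mp hq' with h | h
  · obtain rfl := (Nat.prime_dvd_prime_iff_eq hq Nat.prime_two).mp (hq.dvd_of_dvd_pow h)
    exact ⟨fun _ => by decide, fun h => absurd rfl h⟩
  · obtain rfl := (Nat.prime_dvd_prime_iff_eq hq (by norm_num)).mp h
    exact ⟨fun h => absurd h (by norm_num), fun _ => by norm_num⟩

/-- **`E(ℚ)[2] = 0` for `E = 44a1`** in Kriz–Li's shape (`E[2]` irreducible: GEN 6's `irr_two_44A1`).
[cite: KrizLi2019, Thm. 5.1 hypothesis "E(ℚ)[2] = 0"] -/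
theorem twoTorsion_44A1 :
    haveI := isElliptic_44A1
    ∀ Q : (⟨0, 1, 0, 3, -1⟩ : WeierstrassCurve ℚ).toAffine.Point, 2 • Q = 0 → Q = 0 :=
  haveI := isElliptic_44A1
  (X5.O1.irr_two_iff_forall_two_nsmul _).mp irr_two_44A1

/-- **Kriz–Li's local hypotheses at `2` for `E = 44a1`**: `c₂(E)` odd (kernel: type `IV*`, `c₂ ∣ 3`) and — `E` being ADDITIVE at `2` — the
Manin constant `Dt.c` of the OPTIMAL datum odd, by print (Agashe–Ribet–Stein Thm. 2.6 / Cremona: `|c| = 1` at level `≤ 130000`, `h26`).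
[cite: KrizLi2019, Thm. 5.1 hypotheses "c₂(E) odd; Manin constant odd if additive at 2"] [cite: AgasheRibetStein2006, Thm. 2.6] -/
theorem krizLi_loc_44A1 (h26 : cremona_abs_maninConstant_eq_one_of_level_le)
    [hN : haveI := isElliptic_44A1; NeZero ((⟨0, 1, 0, 3, -1⟩ : WeierstrassCurve ℚ).conductorNorm ℤ)]
    (Dt : haveI := isElliptic_44A1; ModularParametrizationData (⟨0, 1, 0, 3, -1⟩ : WeierstrassCurve ℚ)
      ((⟨0, 1, 0, 3, -1⟩ : WeierstrassCurve ℚ).conductorNorm ℤ))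
    (hopt : haveI := isElliptic_44A1; Zhai2021.IsOptimalDatum (⟨0, 1, 0, 3, -1⟩ : WeierstrassCurve ℚ) Dt) :
    haveI := isElliptic_44A1; haveI : Fact (2 : ℕ).Prime := ⟨Nat.prime_two⟩
    Odd (((⟨0, 1, 0, 3, -1⟩ : WeierstrassCurve ℚ).baseChange ℚ_[2]).localTamagawaNumber ℤ_[2]) ∧
      (¬ (⟨0, 1, 0, 3, -1⟩ : WeierstrassCurve ℚ).HasGoodReductionAtPrime 2 →
        ¬ (⟨0, 1, 0, 3, -1⟩ : WeierstrassCurve ℚ).HasMultiplicativeReductionAtPrime 2 → Odd Dt.c) := by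
  haveI := isElliptic_44A1; haveI := isGloballyMinimal_44A1
  refine ⟨odd_localTamagawaNumber_two_44A1, fun _ _ => ?_⟩
  have hc : ¬ (2 : ℤ) ∣ Dt.c := not_two_dvd_c_of_level_le h26 _ Dt hopt conductorNorm_le_44A1
  exact Int.not_even_iff_odd.mp fun h => hc (even_iff_two_dvd.mp h)

/-- The partner model `[0,−7,0,147,343]` IS a model of `44a1^{(d_K)}` for `d_K = −7` (with the identity change of variables).
[cite: SilvermanAEC2009, X.5 Cor. 5.4] -/
theorem partner_44A1 {K : Type} [Field K] [NumberField K] (hdK : NumberField.discr K = -7) :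
    ∃ C : VariableChange ℚ, C • (⟨0, 1, 0, 3, -1⟩ : WeierstrassCurve ℚ).quadraticTwist (NumberField.discr K : ℚ) =
      (⟨0, -7, 0, 147, 343⟩ : WeierstrassCurve ℚ) :=
  ⟨1, by rw [one_smul, hdK]; push_cast; exact quadraticTwist_neg7_44A1⟩

end Base44A1Field

/-! ## §2 THE ROAD AT `44a1` with the (★)-datum DISPLAYED (any `K` with `d_K = −7`) -/
section Road44A1

/-- **`BSD(W′, 2)` at EVERY global minimal `W′ ≅ 44a1^{(d)}` or `≅ 44a1^{(−7d)}`, `d ∈ 𝒩(44a1, K)`, `χ_d(−44) = 1`** — the (★)-datum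
(`Dt` OPTIMAL, `H`, `ι`, `P ↦` Heegner point, `j`, (★)) displayed; everything else kernel or by name (Kriz–Li Thm 5.1 (2) + 4.3, Creutz–Miller
on `44` and `2156`, ARS). NO rank input. BSD is not proved by any of this.
[cite: KrizLi2019, Thm. 5.1 (2) and Thm. 4.3] [cite: CreutzMiller2012, Thm. 1.1] [cite: AgasheRibetStein2006, Thm. 2.6] [cite: Miller2011LMS, Def. 1.1] -/
theorem krizLi_bsdp_two_of_twist_44A1 (hKL : KrizLi2019.thm112_bsdTwo_twist) (h33 : KrizLi2019.thm33_rank_twist)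
    (hS31 : bsdTriple_of_analyticRank_le_one_of_conductor_lt) (h26 : cremona_abs_maninConstant_eq_one_of_level_le)
    (K : Type) [Field K] [NumberField K] (hK : IsImaginaryQuadratic K) (hdK : NumberField.discr K = -7)
    [hN : haveI := isElliptic_44A1; NeZero ((⟨0, 1, 0, 3, -1⟩ : WeierstrassCurve ℚ).conductorNorm ℤ)]
    (Dt : haveI := isElliptic_44A1; ModularParametrizationData (⟨0, 1, 0, 3, -1⟩ : WeierstrassCurve ℚ)
      ((⟨0, 1, 0, 3, -1⟩ : WeierstrassCurve ℚ).conductorNorm ℤ))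
    (hopt : haveI := isElliptic_44A1; Zhai2021.IsOptimalDatum (⟨0, 1, 0, 3, -1⟩ : WeierstrassCurve ℚ) Dt)
    (H : haveI := isElliptic_44A1; HeegnerDatum ((⟨0, 1, 0, 3, -1⟩ : WeierstrassCurve ℚ).conductorNorm ℤ) (NumberField.discr K))
    (ι : K →+* ℂ) (P : ((⟨0, 1, 0, 3, -1⟩ : WeierstrassCurve ℚ).baseChange K).toAffine.Point)
    (hP : WeierstrassCurve.Affine.Point.map ι.toRatAlgHom P = heegnerPointComplex Dt H)
    (j : K →ₐ[ℚ] ℚ_[2]) (hstar : haveI := isGloballyMinimal_44A1; KrizLi2019.AssumptionStar (⟨0, 1, 0, 3, -1⟩ : WeierstrassCurve ℚ) Dt K P j)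
    {d : ℤ} (hd : haveI := isGloballyMinimal_44A1; KrizLi2019.InN (⟨0, 1, 0, 3, -1⟩ : WeierstrassCurve ℚ) K d)
    (hsign : haveI := isElliptic_44A1; Int.sign d * jacobiSym ((⟨0, 1, 0, 3, -1⟩ : WeierstrassCurve ℚ).conductorNorm ℤ) d.natAbs = 1)
    (W' : WeierstrassCurve ℚ) [W'.IsElliptic] [W'.IsGloballyMinimal]
    (hW' : (∃ C : VariableChange ℚ, C • (⟨0, 1, 0, 3, -1⟩ : WeierstrassCurve ℚ).quadraticTwist (d : ℚ) = W') ∨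
      (∃ C : VariableChange ℚ, C • (⟨0, 1, 0, 3, -1⟩ : WeierstrassCurve ℚ).quadraticTwist ((d * NumberField.discr K : ℤ) : ℚ) = W')) :
    BSDp W' 2 := by
  haveI := isElliptic_44A1; haveI := isGloballyMinimal_44A1
  haveI := isElliptic_T44A1; haveI := isGloballyMinimal_T44A1
  exact krizLi_bsdp_two_of_twist_of_conductor_lt _ hKL h33 hS31 conductorNorm_lt_5000_44A1 twoTorsion_44A1 K hK
    (satisfiesHeegnerHypothesis_44A1 hK.1 hdK) Dt H ι P hP j hstar (krizLi_loc_44A1 h26 Dt hopt) (⟨0, -7, 0, 147, 343⟩ : WeierstrassCurve ℚ)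
    (partner_44A1 hdK) conductorNorm_lt_5000_T44A1 hd hsign W' hW'

end Road44A1

/-! ## §3 THE ROAD AT `44a1` FROM THE PRINTED TABLE-2 ROW, BY NAME -/
section Road44A1ByName

/-- **`2`-PART OF BSD ON THE KRIZ–LI FAMILY OF `44a1` — BY NAME.** Granted Kriz–Li 2019 Thm 5.1 (2) (`hKL`), Thm 4.3 (`h33`), the Table-2 row
of `44a1` (`htab`: optimal datum and Heegner point over `ℚ(√−7)` with (★)), Creutz–Miller (`hS31`) and Agashe–Ribet–Stein (`h26`): for every
imaginary quadratic `K` with `d_K = −7`, every `d ∈ 𝒩(44a1, K)` with `χ_d(−44) = 1`, and EVERY global minimal `W′ ≅ 44a1^{(d)}` or `≅ 44a1^{(−7d)}`,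
`BSD(W′, 2)` holds. Kernel: `E(ℚ)[2] = 0`, Heegner hypothesis, `c₂` odd, `N = 44`, `N(44a1^{(−7)}) = 2156`. No displayed input.
BSD is not proved by any of this. [cite: KrizLi2019, Thm. 5.1 (2), Thm. 4.3, §6 Table 2 (row 44a1), Example 6.5] [cite: CreutzMiller2012, Thm. 1.1]
[cite: AgasheRibetStein2006, Thm. 2.6] [cite: Miller2011LMS, Def. 1.1] -/
theorem krizLi_bsdp_two_of_twist_44A1_of_table2 (hKL : KrizLi2019.thm112_bsdTwo_twist) (h33 : KrizLi2019.thm33_rank_twist)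
    (htab : KrizLi2019.table2_row44a1) (hS31 : bsdTriple_of_analyticRank_le_one_of_conductor_lt)
    (h26 : cremona_abs_maninConstant_eq_one_of_level_le)
    (K : Type) [Field K] [NumberField K] (hK : IsImaginaryQuadratic K) (hdK : NumberField.discr K = -7)
    {d : ℤ} (hd : haveI := isGloballyMinimal_44A1; KrizLi2019.InN (⟨0, 1, 0, 3, -1⟩ : WeierstrassCurve ℚ) K d)
    (hsign : haveI := isElliptic_44A1; Int.sign d * jacobiSym ((⟨0, 1, 0, 3, -1⟩ : WeierstrassCurve ℚ).conductorNorm ℤ) d.natAbs = 1)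
    (W' : WeierstrassCurve ℚ) [W'.IsElliptic] [W'.IsGloballyMinimal]
    (hW' : (∃ C : VariableChange ℚ, C • (⟨0, 1, 0, 3, -1⟩ : WeierstrassCurve ℚ).quadraticTwist (d : ℚ) = W') ∨
      (∃ C : VariableChange ℚ, C • (⟨0, 1, 0, 3, -1⟩ : WeierstrassCurve ℚ).quadraticTwist ((-7 * d : ℤ) : ℚ) = W')) :
    BSDp W' 2 := by
  haveI := isElliptic_44A1; haveI := isGloballyMinimal_44A1
  obtain ⟨_, Dt, H, ι, P, j, hopt, hP, hstar⟩ := htab K hK hdK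
  have hdK' : ((d * NumberField.discr K : ℤ) : ℚ) = ((-7 * d : ℤ) : ℚ) := by rw [hdK]; push_cast; ring
  exact krizLi_bsdp_two_of_twist_44A1 hKL h33 hS31 h26 K hK hdK Dt hopt H ι P hP j hstar hd hsign W' (by rw [hdK']; exact hW')

/-- **THE K4-KEYED RANK-ZERO MEMBERS `44a1^{(d)}` — BY NAME from the Table-2 row**: at EVERY global minimal `W₁ ≅ 44a1^{(d)}`, `d ∈ 𝒩(44a1, K)`,
`χ_d(−44) = 1`: `r_an(W₁) = 0 ∧ Addv W₁ 2 ∧ 0 ≤ ord₂ j(W₁) ∧ ¬CM ∧ Irr W₁ 2 ∧ BSD(W₁, 2) ∧ MissingLowerBoundAt W₁ 2 ∧ MissingUpperBoundAt W₁ 2`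
— C3″'s conclusion AND the Kato-side half on an infinite `E[2]`-IRREDUCIBLE additive potentially-good family. Displayed: `r_an(44a1) = 0`
(Cremona Table 1; Kriz–Li Table 2 caption). By name: Thm 5.1 (2), Thm 4.3, Table-2 row, Creutz–Miller, ARS, GZK. BSD is not proved by any of this.
[cite: KrizLi2019, Thm. 5.1 (2), Thm. 4.3, §6 Table 2 (row 44a1)] [cite: CreutzMiller2012, Thm. 1.1] [cite: AgasheRibetStein2006, Thm. 2.6]
[cite: CremonaAlgorithms1997, Table 1 (44A1: r = 0)] [cite: Miller2011LMS, Def. 1.1] -/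
theorem printFamily44A1_krizLi_rankZero (hKL : KrizLi2019.thm112_bsdTwo_twist) (h33 : KrizLi2019.thm33_rank_twist)
    (htab : KrizLi2019.table2_row44a1) (hS31 : bsdTriple_of_analyticRank_le_one_of_conductor_lt)
    (h26 : cremona_abs_maninConstant_eq_one_of_level_le) (hGZK : rank_eq_analyticRank_of_analyticRank_le_one)
    (hr : haveI := isElliptic_44A1; (⟨0, 1, 0, 3, -1⟩ : WeierstrassCurve ℚ).analyticRank = 0)
    (K : Type) [Field K] [NumberField K] (hK : IsImaginaryQuadratic K) (hdK : NumberField.discr K = -7)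
    {d : ℤ} (hd : haveI := isGloballyMinimal_44A1; KrizLi2019.InN (⟨0, 1, 0, 3, -1⟩ : WeierstrassCurve ℚ) K d)
    (hsign : haveI := isElliptic_44A1; Int.sign d * jacobiSym ((⟨0, 1, 0, 3, -1⟩ : WeierstrassCurve ℚ).conductorNorm ℤ) d.natAbs = 1)
    (W₁ : WeierstrassCurve ℚ) [W₁.IsElliptic] [W₁.IsGloballyMinimal]
    (hW₁ : ∃ C : VariableChange ℚ, C • (⟨0, 1, 0, 3, -1⟩ : WeierstrassCurve ℚ).quadraticTwist (d : ℚ) = W₁) :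
    haveI : Fact (Nat.Prime 2) := ⟨Nat.prime_two⟩
    W₁.analyticRank = 0 ∧ Addv W₁ 2 ∧ 0 ≤ padicValRat 2 W₁.j ∧ ¬ W₁.HasCM ∧ Irr W₁ 2 ∧
      BSDp W₁ 2 ∧ MissingLowerBoundAt W₁ 2 ∧ MissingUpperBoundAt W₁ 2 := by
  haveI := isElliptic_44A1; haveI := isGloballyMinimal_44A1
  haveI := isElliptic_T44A1; haveI := isGloballyMinimal_T44A1
  obtain ⟨_, Dt, H, ι, P, j, hopt, hP, hstar⟩ := htab K hK hdK
  exact printFamilyKrizLi_rankZero _ hKL h33 hS31 hGZK conductorNorm_lt_5000_44A1 hr addv_two_44A1 (by rw [padicValRat_j_44A1]; norm_num)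
    not_hasCM_44A1 irr_two_44A1 K hK (satisfiesHeegnerHypothesis_44A1 hK.1 hdK) Dt H ι P hP j hstar (krizLi_loc_44A1 h26 Dt hopt)
    (⟨0, -7, 0, 147, 343⟩ : WeierstrassCurve ℚ) (partner_44A1 hdK) conductorNorm_lt_5000_T44A1 hd hsign W₁ hW₁

/-- **THE RANK-ONE COMPANIONS `44a1^{(−7d)}` — BY NAME**: at every global minimal `W₂ ≅ 44a1^{(−7d)}` (`d ∈ 𝒩(44a1, K)`, `χ_d(−44) = 1`):
`r_an(W₂) = 1`, `W₂` ADDITIVE and POTENTIALLY GOOD at `2`, NON-CM, `W₂[2]` IRREDUCIBLE, and `BSD(W₂, 2)` — a print-decided RANK-ONE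
`E[2]`-irreducible additive family (bears on K4's `RankOneAtTwo` children; recorded, not this seat's item). Displayed: `r_an(44a1) = 0`.
BSD is not proved by any of this. [cite: KrizLi2019, Thm. 5.1 (2), Thm. 4.3, §6 Table 2 (row 44a1)] [cite: CreutzMiller2012, Thm. 1.1]
[cite: AgasheRibetStein2006, Thm. 2.6] [cite: Miller2011LMS, Def. 1.1] -/
theorem printFamily44A1_krizLi_rankOne (hKL : KrizLi2019.thm112_bsdTwo_twist) (h33 : KrizLi2019.thm33_rank_twist)
    (htab : KrizLi2019.table2_row44a1) (hS31 : bsdTriple_of_analyticRank_le_one_of_conductor_lt)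
    (h26 : cremona_abs_maninConstant_eq_one_of_level_le)
    (hr : haveI := isElliptic_44A1; (⟨0, 1, 0, 3, -1⟩ : WeierstrassCurve ℚ).analyticRank = 0)
    (K : Type) [Field K] [NumberField K] (hK : IsImaginaryQuadratic K) (hdK : NumberField.discr K = -7)
    {d : ℤ} (hd : haveI := isGloballyMinimal_44A1; KrizLi2019.InN (⟨0, 1, 0, 3, -1⟩ : WeierstrassCurve ℚ) K d)
    (hsign : haveI := isElliptic_44A1; Int.sign d * jacobiSym ((⟨0, 1, 0, 3, -1⟩ : WeierstrassCurve ℚ).conductorNorm ℤ) d.natAbs = 1)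
    (W₂ : WeierstrassCurve ℚ) [W₂.IsElliptic] [W₂.IsGloballyMinimal]
    (hW₂ : ∃ C : VariableChange ℚ, C • (⟨0, 1, 0, 3, -1⟩ : WeierstrassCurve ℚ).quadraticTwist ((-7 * d : ℤ) : ℚ) = W₂) :
    haveI : Fact (Nat.Prime 2) := ⟨Nat.prime_two⟩
    W₂.analyticRank = 1 ∧ Addv W₂ 2 ∧ 0 ≤ padicValRat 2 W₂.j ∧ ¬ W₂.HasCM ∧ Irr W₂ 2 ∧ BSDp W₂ 2 := by
  haveI := isElliptic_44A1; haveI := isGloballyMinimal_44A1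
  haveI := isElliptic_T44A1; haveI := isGloballyMinimal_T44A1
  obtain ⟨_, Dt, H, ι, P, j, hopt, hP, hstar⟩ := htab K hK hdK
  have hdK' : ((d * NumberField.discr K : ℤ) : ℚ) = ((-7 * d : ℤ) : ℚ) := by rw [hdK]; push_cast; ring
  exact printFamilyKrizLi_rankOne _ hKL h33 hS31 conductorNorm_lt_5000_44A1 hr addv_two_44A1 (by rw [padicValRat_j_44A1]; norm_num)
    not_hasCM_44A1 irr_two_44A1 K hK (by rw [hdK]; decide) (satisfiesHeegnerHypothesis_44A1 hK.1 hdK) Dt H ι P hP j hstar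
    (krizLi_loc_44A1 h26 Dt hopt) (⟨0, -7, 0, 147, 343⟩ : WeierstrassCurve ℚ) (partner_44A1 hdK) conductorNorm_lt_5000_T44A1 hd hsign W₂
    (by rw [hdK']; exact hW₂)

end Road44A1ByName

end Summit.BirchSwinnertonDyer.BirchSwinnertonDyer.Theorems.AddPotGoodPrint

end
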